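import Summits.CriticalPhenomena.PercolationContinuityZ3.Theorems.PercNearOneGluingNoHeavyPcintBSMRZ5QSRowsA
import HarnessLib

/-!
# PCINT lane, PHASE 12 (site plane method for `d = 5`, reach-4 pieces (two-turn family), long horizon): kernel checks 3/4 of the checkpoint chain for site `ℤ^5`

Cell `prim-pcint`, seat `prim-pcint-4` (gen 0); memo `run/shared/lean/prim/pcint/T-FIBRE-ROUTE.md` §PHASE 12.
Instance `Z5QS`: `d = 5 = 3 + 2` (`k = 3` time axes, the transverse plane), SITE percolation, 337 two-turn reach-4 pieces
(`BSMR.pc4`), 9-point law `A/DA = [3, 10, 32, 90, 730, 90, 32, 10, 3]/1000`, horizon `N = 1000` in `20` chunks of `50` (window half-width `220`),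
coefficient tables exact below `M` and flat beyond (…PcintBSMRCoefFlat), Fourier tail (cut-off data, `θ₀ = 1/2`, `q₀ = 333`)
`T = 163016495/10^12`, cell `p = 2476/10^4`. `rowLE (hrowFrom starts[c] (2L)) starts[c+1]`.
-/

namespace Summit.CriticalPhenomena.PercolationContinuityZ3.Theorems.Pcint.BSMR.Z5QS

open Summit.CriticalPhenomena.PercolationContinuityZ3.Theorems.Pcint.BSMR Summit.CriticalPhenomena.PercolationContinuityZ3.Theorems.Pcint.BSMX Summit.CriticalPhenomena.PercolationContinuityZ3.Theorems.Pcint.BSM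

set_option maxHeartbeats 0 in
set_option maxRecDepth 65536 in
/-- Checkpoint `11` dominates the rows continued from checkpoint `10` (the law is restated to keep the statement
instance-specific). -/
theorem hn_10 : lawA = [3, 10, 32, 90, 730, 90, 32, 10, 3] ∧ ∀ c ∈ (((List.range 19).drop 10).take 1),
    BSMX.rowLE (hrowFrom 4 lawA 1000 1000000000000000 (starts.getD c []) (2 * 50)) (starts.getD (c + 1) []) = true := by
  refine ⟨rfl, ?_⟩
  decide +kernel

set_option maxHeartbeats 0 in
set_option maxRecDepth 65536 in
/-- Checkpoint `12` dominates the rows continued from checkpoint `11` (the law is restated to keep the statement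
instance-specific). -/
theorem hn_11 : lawA = [3, 10, 32, 90, 730, 90, 32, 10, 3] ∧ ∀ c ∈ (((List.range 19).drop 11).take 1),
    BSMX.rowLE (hrowFrom 4 lawA 1000 1000000000000000 (starts.getD c []) (2 * 50)) (starts.getD (c + 1) []) = true := by
  refine ⟨rfl, ?_⟩
  decide +kernel

set_option maxHeartbeats 0 in
set_option maxRecDepth 65536 in
/-- Checkpoint `13` dominates the rows continued from checkpoint `12` (the law is restated to keep the statement
instance-specific). -/
theorem hn_12 : lawA = [3, 10, 32, 90, 730, 90, 32, 10, 3] ∧ ∀ c ∈ (((List.range 19).drop 12).take 1),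
    BSMX.rowLE (hrowFrom 4 lawA 1000 1000000000000000 (starts.getD c []) (2 * 50)) (starts.getD (c + 1) []) = true := by
  refine ⟨rfl, ?_⟩
  decide +kernel

set_option maxHeartbeats 0 in
set_option maxRecDepth 65536 in
/-- Checkpoint `14` dominates the rows continued from checkpoint `13` (the law is restated to keep the statement
instance-specific). -/
theorem hn_13 : lawA = [3, 10, 32, 90, 730, 90, 32, 10, 3] ∧ ∀ c ∈ (((List.range 19).drop 13).take 1),
    BSMX.rowLE (hrowFrom 4 lawA 1000 1000000000000000 (starts.getD c []) (2 * 50)) (starts.getD (c + 1) []) = true := by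
  refine ⟨rfl, ?_⟩
  decide +kernel

set_option maxHeartbeats 0 in
set_option maxRecDepth 65536 in
/-- Checkpoint `15` dominates the rows continued from checkpoint `14` (the law is restated to keep the statement
instance-specific). -/
theorem hn_14 : lawA = [3, 10, 32, 90, 730, 90, 32, 10, 3] ∧ ∀ c ∈ (((List.range 19).drop 14).take 1),
    BSMX.rowLE (hrowFrom 4 lawA 1000 1000000000000000 (starts.getD c []) (2 * 50)) (starts.getD (c + 1) []) = true := by
  refine ⟨rfl, ?_⟩
  decide +kernel


end Summit.CriticalPhenomena.PercolationContinuityZ3.Theorems.Pcint.BSMR.Z5QS
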